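import Summits.BirchSwinnertonDyer.Rank1Residual.X12.O11.RamifiedRelativeValuationLineZp
import Summits.BirchSwinnertonDyer.BirchSwinnertonDyer.Theorems.RamifiedSevenEllipticUnitsPadicComplexTransfer
import HarnessLib

set_option linter.dupNamespace false
set_option autoImplicit false

/-!
# K7r crux `EllipticUnitValueSevenOfGZK` (stmt-BirchSwinnertonDyer-19945), line `rubin-formula-zp` v3 —
# S_relval (`X12.O11.RamifiedCMRelativeValuationAtZp W p D₀`) REDUCED IN THE KERNEL to VALUATION DATA IN
# `ℚ̄_p = PadicAlgCl p` (the currency of the [BKNO] interface's `ι.symm`-readings), squared form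
# (cell `bsd-cm`, seat `bsd-cm-k7r-c3` g9; helper, `--supports` 19945; the `ℚ̄_p` twin of
# `…RelativeValuationOfFrameData.lean`, over `…PadicComplexTransfer.lean` p491487)

HONEST FRAMING. Nothing is asserted about the crux; no definition, no named fact, `sorry`-free; BSD is not
proved by any of this. As in the `K_𝔭` twin: the (T4) typing of [BKNO] Def. 4.7 / Thm. 4.12 / Thm. 7.2
(tabled with bsd-littype-10) will deliver the inputs of ram g9's relative valuation theorem as statements
about elements of a value field; if that field is `ℚ̄_p` (values `ι.symm z`, `Valued.v = ‖·‖₊`, `v p = 1/p`,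
so `ord_π = 1` reads `(Valued.v ·)² = 1/p`), S_relval follows from the data `a = 𝓛_W(ξ)`, `c = 𝓛_W(𝟙)`,
`x = ξ(γ) − 1`, `u = φ_ac(γ)`, `ℓ₀ = 𝓛_{W₀}(ξ)`, `per`, `per₀`, `A₀ ≠ 0`, `ρ` in `ℚ̄_p` subject to
`v (a − c) ≤ v x` [(vi)], `(v (u − 1))² = v p` [(F2)], `x = u^{p^m} − 1`, `a · per = A₀ · ρ`, `ℓ₀ · per₀ = A₀`
[(iii)], `v per = v per₀` [(iv)], `v ℓ₀ = 1` [(v)], `ρ² = ι.symm r` [the v3 carrier identity transported by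
`ι.symm`], `(v c)² = p^(−l)` [Thm. 7.2 at `𝟙`], with `p ≥ 5` supplied by the frame:
* `Ultrametric.natCast_eq_padicValRat_of_map_sub_le_padicAlgCl` — the ELEMENTS-ONLY endgame in `ℚ̄_p`.
* `RelativeValuationOfPadicAlgClData.ramifiedCMRelativeValuationAtZp_of_padicAlgClValuationData` —
  **S_relval from its own telescope ending in `∃ a c x u ℓ₀ per per₀ A₀ ρ : PadicAlgCl p, …`**.
References: [BKNO] arXiv:2608.06879 Def. 4.7, Thm. 4.12, Thm. 7.2 (shapes only)
[BurungaleKobayashiNakamuraOta2026]; J.-P. Serre, *Local Fields* (1979) Ch. II §1, XIV §4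
[Serre1979]; memo RELATIVE-RUBIN-ram-g9.md §1 THEOREM (2); cell STATUS D123/D127/D128.
-/

noncomputable section

open scoped Classical NNReal

namespace Summit.BirchSwinnertonDyer.BirchSwinnertonDyer.Theorems.RamifiedSevenEllipticUnits

open WeierstrassCurve NumberField IsDedekindDomain IsDedekindDomain.HeightOneSpectrum Field PowerSeries
  Literature.NumberTheory.EllipticCurves
  Literature.NumberTheory.EllipticCurves.Rank1Residual
  Literature.NumberTheory.EllipticCurves.BurungaleKobayashiNakamuraOta2026
  Literature.NumberTheory.EllipticCurves.Castella2018
  Literature.NumberTheory.GaloisRepresentations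
  Literature.NumberTheory.DiophantineGeometry
  Summit.BirchSwinnertonDyer.Rank1Residual
  Summit.BirchSwinnertonDyer.Rank1Residual.Additive
  Summit.BirchSwinnertonDyer.Rank1Residual.X12
  Summit.BirchSwinnertonDyer.Rank1Residual.X12.O11

namespace Ultrametric

variable {p : ℕ} [hp : Fact p.Prime]

/-- **«`ord 𝓛_W(ξ) = ord ρ`» from elements of `ℚ̄_p`**: `a · per = A₀ · ρ`, `ℓ₀ · per₀ = A₀`,
`v per = v per₀` [(iv)], `v ℓ₀ = 1` [(v)], `A₀ ≠ 0` ⇒ `Valued.v a = Valued.v ρ`.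
[cite: BurungaleKobayashiNakamuraOta2026, Thm. 4.12 (arXiv:2608.06879 p. 32) (claim; preprint; shape only)] -/
theorem valued_eq_of_interpolation_padicAlgCl {a ℓ₀ per per₀ A₀ ρ : PadicAlgCl p}
    (hD : a * per = A₀ * ρ) (hD₀ : ℓ₀ * per₀ = A₀) (hper : Valued.v per = Valued.v per₀)
    (hunit : Valued.v ℓ₀ = 1) (hA₀ : A₀ ≠ 0) : Valued.v a = Valued.v ρ := by
  have hA₀' : Valued.v A₀ ≠ 0 := (Valuation.ne_zero_iff _).2 hA₀
  have h := map_mul_eq_of_interpolation Valued.v hD hD₀ hper hunit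
  rw [map_mul, mul_comm (Valued.v A₀)] at h
  exact mul_right_cancel₀ hA₀' h

/-- **THE ELEMENTS-ONLY ENDGAME IN `ℚ̄_p` (squared currency).** For `p ≥ 5` and elements `a = 𝓛_W(ξ)`,
`c = 𝓛_W(𝟙)`, `x = u^{p^m} − 1` of `ℚ̄_p` with `v (a − c) ≤ v x` [(vi)], `(v (u − 1))² = v p` [(F2)], the
interpolation identities `a · per = A₀ · ρ`, `ℓ₀ · per₀ = A₀` [(iii)], `v per = v per₀` [(iv)], `v ℓ₀ = 1`
[(v)], `A₀ ≠ 0`, `ρ² = ι.symm r` with `r ∈ ℚ^×`, the threshold `padicValRat p r < 1 + 2m`, and the bottom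
reading `(v c)² = p^(−l)` [Thm. 7.2 at `𝟙`]: `(l : ℤ) = padicValRat p r`.
[cite: BurungaleKobayashiNakamuraOta2026, Thm. 4.12, Def. 4.7 and Thm. 7.2 (arXiv:2608.06879 pp. 27, 32, 41) (claim; preprint; shape only)] -/
theorem natCast_eq_padicValRat_of_map_sub_le_padicAlgCl (h5 : 5 ≤ p) (ι : PadicAlgCl p ≃+* ℂ)
    {a c x u ℓ₀ per per₀ A₀ ρ : PadicAlgCl p} {m l : ℕ} {r : ℚ}
    (hsub : Valued.v (a - c) ≤ Valued.v x) (hu : Valued.v (u - 1) ^ 2 = Valued.v (p : PadicAlgCl p))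
    (hx : x = u ^ (p ^ m) - 1) (hD : a * per = A₀ * ρ) (hD₀ : ℓ₀ * per₀ = A₀)
    (hper : Valued.v per = Valued.v per₀) (hunit : Valued.v ℓ₀ = 1) (hA₀ : A₀ ≠ 0) (hr : r ≠ 0)
    (hρ : ρ ^ 2 = ι.symm (r : ℂ)) (hlt : padicValRat p r < 1 + 2 * (m : ℤ))
    (hbottom : Valued.v c ^ 2 = (p : ℝ≥0) ^ (-(l : ℤ))) : (l : ℤ) = padicValRat p r := by
  have hp1 : (1 : ℝ≥0) < (p : ℝ≥0) := by exact_mod_cast hp.out.one_lt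
  have hx2 : Valued.v x ^ 2 = (p : ℝ≥0) ^ (-(1 + 2 * (m : ℤ))) := by
    have h := (valued_one_add_pow_prime_pow_sub_one_padicAlgCl h5 hu m).2
    rw [add_sub_cancel] at h
    rw [hx]
    exact h
  have hvρ := valued_sq_eq_of_sq_eq_symm_ratCast ι hr hρ
  have hva : Valued.v a = Valued.v ρ := valued_eq_of_interpolation_padicAlgCl hD hD₀ hper hunit hA₀
  have hlt' : Valued.v x < Valued.v a := by
    rw [hva, ← pow_lt_pow_iff_left₀ zero_le zero_le two_ne_zero, hx2, hvρ,
      zpow_lt_zpow_iff_right₀ hp1]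
    linarith
  have h := map_const_eq_of_map_sub_le_of_lt Valued.v hsub hlt'
  have h2 : (p : ℝ≥0) ^ (-(l : ℤ)) = (p : ℝ≥0) ^ (-padicValRat p r) := by rw [← hbottom, h, hva, hvρ]
  have h3 := (zpow_right_strictMono₀ hp1).injective h2
  linarith

end Ultrametric

namespace RelativeValuationOfPadicAlgClData

variable {W : WeierstrassCurve ℚ} [W.IsElliptic] [W.IsGloballyMinimal] {p : ℕ} [Fact p.Prime] {D₀ : ℤ}

omit [W.IsGloballyMinimal] in
/-- **S_relval FROM `ℚ̄_p` VALUATION DATA (kernel reduction, squared currency).** If at every instance of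
S_relval's telescope THERE ARE elements `a c x u ℓ₀ per per₀ A₀ ρ` of `ℚ̄_p = PadicAlgCl p` with
`v (a − c) ≤ v x` [(vi)], `(v (u − 1))² = v p` [(F2)], `x = u^{p^m} − 1`, `a · per = A₀ · ρ`,
`ℓ₀ · per₀ = A₀` [(iii) for `W` and `W₀`], `v per = v per₀` [(iv)], `v ℓ₀ = 1` [(v)], `A₀ ≠ 0`,
`ρ² = ι.symm r` and `(v c)² = p^(−l)` [Thm. 7.2 at `𝟙`], THEN `RamifiedCMRelativeValuationAtZp W p D₀`
(the frame supplies `p ≥ 5`). [cite: BurungaleKobayashiNakamuraOta2026, Thm. 4.12, Def. 4.7 and Thm. 7.2 (arXiv:2608.06879 pp. 27, 32, 41) (claim; preprint; shape only)] -/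
theorem ramifiedCMRelativeValuationAtZp_of_padicAlgClValuationData
    (h : ∀ (K : Type) [Field K] [NumberField K] (𝔭 : HeightOneSpectrum (𝓞 K))
      (W' : WeierstrassCurve ℚ) [W'.IsElliptic] [W'.IsGloballyMinimal] (C : VariableChange ℚ),
      IsFrame W p K 𝔭 W' C → W.analyticRank = 1 →
      ∀ (κ : ZpExtension K p), κ.IsAnticyclotomic →
        ∀ (γ : absoluteGaloisGroup K) [Fact (κ.IsTopGenerator γ)]
          (P : W.toAffine.Point) (n : ℕ) (P' : W'.toAffine.Point) (n' : ℕ),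
          ¬ IsOfFinAddOrder P →
          (∀ R : W.toAffine.Point, ∃ (k : ℤ) (T : W.toAffine.Point), IsOfFinAddOrder T ∧ R = k • P + T) →
          (∀ Q : (W.baseChange ℚ_[p]).toAffine.Point, p • Q = 0 → Q = 0) →
          (∃ Q : (W.baseChange ℚ_[p]).toAffine.Point, p ^ n • Q = W.toPadicPoint p P) →
          (∀ Q : (W.baseChange ℚ_[p]).toAffine.Point, p ^ (n + 1) • Q ≠ W.toPadicPoint p P) →
          ¬ IsOfFinAddOrder P' →
          (∀ R : W'.toAffine.Point, ∃ (k : ℤ) (T : W'.toAffine.Point),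
            IsOfFinAddOrder T ∧ R = k • P' + T) →
          (∀ Q : (W'.baseChange ℚ_[p]).toAffine.Point, p • Q = 0 → Q = 0) →
          (∃ Q : (W'.baseChange ℚ_[p]).toAffine.Point, p ^ n' • Q = W'.toPadicPoint p P') →
          (∀ Q : (W'.baseChange ℚ_[p]).toAffine.Point, p ^ (n' + 1) • Q ≠ W'.toPadicPoint p P') →
          ∀ (q q' : ℚ), shaAn W = (q : ℂ) → shaAn W' = (q' : ℂ) →
          ∀ (ι : PadicAlgCl p ≃+* ℂ) (φ : HeckeCharacter K) (Ω : ℂ) (𝓔 : AcDualExpSystem W p K 𝔭 κ ι)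
            (D : EllipticUnitClassData W p K 𝔭 κ γ ι φ Ω 𝓔) (c : ℕ),
            Ω ≠ 0 → (∀ s : ℂ, 3 / 2 < s.re → heckeLFunction φ s = W.LSeries s) →
            D.HasBottomIndexExpZp c →
            (∀ (n₀ : ℕ), AcSelmer.XAc.HasCharValuationAt (W.baseChange K) p κ 𝔭 ∅ γ n₀ →
              Finite {x : AcSelmer.XAc (W.baseChange K) p κ 𝔭 ∅ γ //
                (PowerSeries.X : IwasawaAlgebra p) • x = 0} →
              (n₀ : ℤ) + padicValNat p (Nat.card {x : AcSelmer.XAc (W.baseChange K) p κ 𝔭 ∅ γ //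
                  (PowerSeries.X : IwasawaAlgebra p) • x = 0}) = c) →
            ∀ (l : ℕ), D.HasLocalBottomIndexExpZp l →
              ∀ (W₀ : WeierstrassCurve ℚ) [W₀.IsElliptic] [W₀.IsGloballyMinimal],
                (∃ C₀ : VariableChange ℚ, C₀ • W₀ = cm7.quadraticTwist (D₀ : ℚ)) →
                ∀ (φ₀ : HeckeCharacter K),
                  (∀ s : ℂ, 3 / 2 < s.re → heckeLFunction φ₀ s = W₀.LSeries s) →
                  ∀ (m : ℕ) (r : ℚ),
                    LFunction.HasEntireContinuationFrom (((p ^ m : ℕ) : ℝ) + 3 / 2)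
                        (heckeLFunction (φ ^ (2 * p ^ m + 1))) →
                      LFunction.HasEntireContinuationFrom (((p ^ m : ℕ) : ℝ) + 3 / 2)
                        (heckeLFunction (φ₀ ^ (2 * p ^ m + 1))) →
                    (heckePowerCentralValue φ (p ^ m) / heckePowerCentralValue φ₀ (p ^ m)) ^ 2 = (r : ℂ) →
                    r ≠ 0 → padicValRat p r < 1 + 2 * (m : ℤ) →
                    ∃ (a c' x u ℓ₀ per per₀ A₀ ρ : PadicAlgCl p),
                      Valued.v (a - c') ≤ Valued.v x ∧
                      Valued.v (u - 1) ^ 2 = Valued.v (p : PadicAlgCl p) ∧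
                      x = u ^ (p ^ m) - 1 ∧ a * per = A₀ * ρ ∧ ℓ₀ * per₀ = A₀ ∧
                      Valued.v per = Valued.v per₀ ∧ Valued.v ℓ₀ = 1 ∧ A₀ ≠ 0 ∧
                      ρ ^ 2 = ι.symm (r : ℂ) ∧
                      Valued.v c' ^ 2 = (p : ℝ≥0) ^ (-(l : ℤ))) :
    RamifiedCMRelativeValuationAtZp W p D₀ := by
  intro K _ _ 𝔭 W' _ _ C hF hr κ hκ γ _ P n P' n' hP hgen htors hdiv hndiv hP' hgen' htors' hdiv' hndiv'
    q q' hq hq' ι φ Ω 𝓔 D c hΩ hφ hc himc l hl W₀ _ _ hW₀ φ₀ hφ₀ m r hcont hcont₀ hρ hr0 hlt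
  obtain ⟨a, c', x, u, ℓ₀, per, per₀, A₀, ρ', hsub, hu, hx, hD, hD₀, hper, hunit, hA₀, hρ', hbottom⟩ :=
    h K 𝔭 W' C hF hr κ hκ γ P n P' n' hP hgen htors hdiv hndiv hP' hgen' htors' hdiv' hndiv' q q' hq hq'
      ι φ Ω 𝓔 D c hΩ hφ hc himc l hl W₀ hW₀ φ₀ hφ₀ m r hcont hcont₀ hρ hr0 hlt
  exact Ultrametric.natCast_eq_padicValRat_of_map_sub_le_padicAlgCl hF.2.2.1 ι hsub hu hx hD hD₀ hper
    hunit hA₀ hr0 hρ' hlt hbottom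

end RelativeValuationOfPadicAlgClData

end Summit.BirchSwinnertonDyer.BirchSwinnertonDyer.Theorems.RamifiedSevenEllipticUnits

end
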